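import Literature.MathematicalPhysics.QuantumFieldTheory.Balaban1983to89.FlowStepRuns

/-!
# Gaps / EndRunwiseShooting — THE SUP FORM OF THE SHOOTING ARGUMENT: a SHOOTING DICHOTOMY for the history recursion (0.20), and
# RUN-WISE SUFFICIENCY for the END binder `DagBinding.EndpointExistence` (partial sums bounded below ALONG IN-INTERVAL RUNS of (0.20)
# only — the necessity class of `FlowStepRuns.partialSums_lower_of_endpointRun` — instead of along ALL box histories)
# (cell pub-balaban-gaps, seat g1-p3 gen 6, row CAP+tail ∕ β-currency «split ∕ weakening»; closes the kernel gap recorded by g1-plan-2 as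
# S-33 ∕ R-28: «a run-wise SUFFICIENCY theorem is not in the tree … the shooting proof `FlowStepRuns` :515 consumes the bound along
# trajectories not yet known to be runs»)

HONEST FRAMING (cell rule, page 1 of everything): [folklore] real analysis (a supremum argument on `ℝ`) over the tree's typed carriers
`FlowStep.Y` ∕ `FlowStep.gClamp` (the clamped forward run of `1∕g_k²`), `FlowStep.RGEqH` ((0.20) with history-dependent β, [I] p. 298),
`DagBinding.ForwardGenerated` and `DagBinding.EndpointExistence` (the first sentence of [I] Thm 2 p. 259 — UNPRINTED, «will be given in a
separate paper»; here only a CONCLUSION SHAPE).  NOTHING of Bałaban's is asserted; every β-hypothesis below is a binder; 0∕6 binders of the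
T⁴ headline discharged; 0 coefficients certified; one finite T⁴; NOT B12 Thm 2, NOT `BetaPertH`, NOT the continuum limit, NOT Clay.
HONEST DEPENDENCY (b2b cell, verbatim): «continuum YM on T⁴ ⇐ BetaPertH ∧ nine spine estimates (0/9 proved); BetaPertH ⇐ (D1) ∧ (D4) ∧
CAP+tail; G-an2-4 gates asym, D1 and NE2/3/4.»

THE POINT.  `FlowStepRuns` §7 types the END binder's «exact scale of hypothesis» as (PS) = `BetaPartialSumsLowerH M γ β`: window sums
`Σ_{j∈[k,n)} β_j(g_0,…,g_j) ≥ −M` along ALL histories in `]0,γ]` — SUFFICIENT by forward shooting (:515 ∕ :593, an IVT on the CLAMPED map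
`g₀ ↦ Y_K(g₀)`), NECESSARY only along REALISED in-interval runs (:497, telescoping).  g1-plan-2's model kernel (S-33) separates the two
(END true, (PS) false on every box), so (PS) is not exact.  Here the IVT is replaced by a SUPREMUM over UNCLAMPED survivors:

* §1 — survivors ARE runs: if the clamp never acts up to `K` (`1∕γ² ≤ Y_k(g₀)`, `k ≤ K`), the shooting trajectory `k ↦ ĝ(Y_k(g₀))` solves
  (0.20) (`RGEqH`), lies in `]0,γ]`, starts at `g₀` and has `1∕g_k² = Y_k(g₀)`; conversely along ANY in-interval solution of (0.20) the clamp
  is inactive and the clamped prefixes ARE the run's prefixes (`Y_eq_of_run`).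
* §2 — **THE SHOOTING DICHOTOMY** (`shooting_dichotomy`): `β` jointly continuous on the boxes `]0,γ]^{k+1}`; if SOME survivor `x_s` of
  length `K` ends at or below the target `g` (a seed — supplied e.g. by the printed upper bound `β ≤ β′`, `seed_of_upper`), then EITHER some
  survivor `x ∈ [x_s, γ]` ends EXACTLY at `g` (`Y_K(x) = 1∕g²`), OR some survivor `x ∈ [x_s, γ]` SITS AT `γ` at some step `k ≤ K`
  (`Y_k(x) = 1∕γ²`) and ends STRICTLY BELOW `g`.  (Take `x = sup` of the closed set of survivors ending at or below `g`; if it does not end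
  at `g`, openness of the strict inequalities forces a touch.)  No lower bound on β of any kind enters.
* §3 — **RUN-WISE SUFFICIENCY** (`couplingTrajectory_exists_of_topRuns` ∕ `_of_runwisePS`): continuity + `β ≤ β′` on the boxes + «no
  in-interval RUN of (0.20) that sits at `γ` at step `k` has `Σ_{j∈[k,n)} β_j < −M`» ⟹ every target `g` with `1∕g² ≥ 1∕γ² + M` is hit
  EXACTLY, for every `K` (the touching alternative of §2 is such a run).  A fortiori (PS) along all in-interval runs suffices.  At the
  construction level (`ForwardGenerated` only, as in :593), weakest first: `endpointExistence_of_topRunsPerLevel` (for each level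
  `γ ≤ γ₀` SOME constant `M_γ`: no in-interval run in `]0,γ]` that sits at `γ` falls afterwards by more than `M_γ` in `1∕g²`; g1-plan-2 X-90
  P-2) ⟹ `endpointExistence_of_recordRuns` (one `M`: no in-interval run ends more than `M` below its own maximum) ⟹
  `endpointExistence_of_runwisePS` (one `M`, all windows).  The CLASSES of histories on the necessity side (:497: realised in-interval runs)
  and on the sufficiency side now COINCIDE; what remains between them is the UNIFORMITY of the constant over runs (necessity gives the
  endpoint-dependent `1∕γ² − 1∕g_n²` along the tuned runs only) — and that residual is SUBSTANTIVE: g1-plan-2's AF-1 END-model (S-33, kernel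
  NOT in the tree) violates every uniform run-wise form on every box (X-90 P-1).
  The sequel `Gaps/EndRunwiseCone` derives the tree's :593 and g1-plan-2's «(PS) along shooting trajectories» as
  COROLLARIES and pushes on to the SIGN on non-decreasing histories and to β-bounds on the RUNNING CONE (the inductive form of Theorem 2's
  hypothesis); the companion definition-lane file `Gaps/EndRunwiseWitness` separates the currencies by one toy family.
RELEVANCE: `EndpointExistence D.C.toB12` is the β-binder `hEnd` of the print-faithful T⁴ headline
`T4ContinuumYM4Torus.continuumYM4_torus_of_endpointExistence`; this file lowers the β-side certificate that discharges it from «(PS) on all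
box histories» (W-β's quarter, `Gaps/WeakestBetaCurrency`) to «(PS) along in-interval runs of (0.20)».  0 sorry; 0 def; imports
`FlowStepRuns` only; restates nothing (every tree lemma used BY NAME).

CITATION HEADER (tags CONTEXT ONLY).  [I] = T. Bałaban, Commun. Math. Phys. **109** (1987) [Balaban1987RG1]: Thm 2 p. 259 (first sentence),
(0.17)–(0.20) pp. 255–256, §1 p. 264 (β «uniformly bounded», continuity), §5 p. 298 (history dependence).
-/

namespace Summit.QuantumFields.BalabanUV.Gaps.EndRunwiseShooting

open Literature.MathematicalPhysics.QuantumFieldTheory.Balaban1983to89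
open Literature.MathematicalPhysics.QuantumFieldTheory.Balaban1983to89.FlowStep
open Literature.MathematicalPhysics.QuantumFieldTheory.Balaban1983to89.FlowStepRuns
open Literature.MathematicalPhysics.QuantumFieldTheory.Balaban1983to89.DagBinding
open Filter Topology Finset

noncomputable section

variable {β : HBeta} {γ : ℝ}

/-! ## §1 Survivors of the clamped shooting ARE in-interval runs of (0.20), and conversely -/

/-- The clamp is the identity on genuine couplings: `ĝ(1∕x²) = x` for `x ∈ ]0,γ]`. [folklore] -/
theorem gClamp_inv_sq {x : ℝ} (hx : 0 < x) (hxγ : x ≤ γ) : gClamp γ (1 / x ^ 2) = x := by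
  have h : 1 / γ ^ 2 ≤ 1 / x ^ 2 := one_div_le_one_div_of_le (by positivity) (pow_le_pow_left₀ hx.le hxγ 2)
  rw [gClamp_eq_of_le h, show (1 : ℝ) / x ^ 2 = (1 / x) ^ 2 by ring, Real.sqrt_sq (by positivity), one_div_one_div]

/-- The shooting trajectory `k ↦ ĝ(Y_k(g₀))` lies in `]0,γ]` (always — this is what the clamp is for). [folklore] -/
theorem inInterval_shoot (hγ : 0 < γ) (K : ℕ) (g₀ : ℝ) :
    Step.InInterval γ K (fun k => gClamp γ (Y β γ k g₀)) :=
  fun _ _ => ⟨gClamp_pos hγ _, gClamp_le hγ _⟩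

/-- The shooting trajectory starts at `g₀` when `g₀ ∈ ]0,γ]`. [folklore] -/
theorem shoot_zero {g₀ : ℝ} (hg₀ : 0 < g₀) (hg₀γ : g₀ ≤ γ) : gClamp γ (Y β γ 0 g₀) = g₀ := by
  rw [Y_zero]; exact gClamp_inv_sq hg₀ hg₀γ

/-- SURVIVORS ARE RUNS.  If the clamp never acts up to `K` (`1∕γ² ≤ Y_k(g₀)` for `k ≤ K`), the shooting trajectory solves the history
recursion (0.20) up to `K` (extracted from the tree's proof of `FlowStepRuns.couplingTrajectory_exists_partialSums`). [cite: Balaban1987RG1, (0.20) p.256] -/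
theorem rgEqH_shoot_of_survives (hγ : 0 < γ) {K : ℕ} {g₀ : ℝ} (hsurv : ∀ k, k ≤ K → 1 / γ ^ 2 ≤ Y β γ k g₀) :
    RGEqH K β (fun k => gClamp γ (Y β γ k g₀)) := by
  intro k hk
  show 1 / (gClamp γ (Y β γ k g₀)) ^ 2 = 1 / (gClamp γ (Y β γ (k + 1) g₀)) ^ 2 + β k _
  rw [inv_sq_gClamp hγ (hsurv k hk.le), inv_sq_gClamp hγ (hsurv (k + 1) hk), Y_succ k g₀]
  have e : prefixOf (fun k => gClamp γ (Y β γ k g₀)) k = fun j : Fin (k + 1) => gClamp γ (Y β γ j g₀) := rfl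
  rw [e]
  ring

/-- A survivor with `Y_K(g₀) = 1∕g²` ends at `g_K = g`. [folklore] -/
theorem shoot_eq_of_Y_eq {K : ℕ} {g₀ g : ℝ} (hg : 0 < g) (hY : Y β γ K g₀ = 1 / g ^ 2)
    (hsurvK : 1 / γ ^ 2 ≤ Y β γ K g₀) : gClamp γ (Y β γ K g₀) = g := by
  rw [gClamp_eq_of_le hsurvK, hY, show (1 : ℝ) / g ^ 2 = (1 / g) ^ 2 by ring, Real.sqrt_sq (by positivity), one_div_one_div]

/-- A survivor with `Y_k(g₀) = 1∕γ²` sits at `g_k = γ`. [folklore] -/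
theorem shoot_eq_top_of_Y_eq (hγ : 0 < γ) {k : ℕ} {g₀ : ℝ} (hY : Y β γ k g₀ = 1 / γ ^ 2) :
    gClamp γ (Y β γ k g₀) = γ := by
  rw [hY]; exact gClamp_inv_sq hγ le_rfl

/-- Window sums along a survivor are differences of `Y` (the tree's `Y_sub_Y` read through `clampPrefix_eq_prefixOf`). [folklore] -/
theorem windowSum_shoot (k n : ℕ) (hkn : k ≤ n) (g₀ : ℝ) :
    ∑ j ∈ Finset.Ico k n, β j (prefixOf (fun i => gClamp γ (Y β γ i g₀)) j) = Y β γ k g₀ - Y β γ n g₀ := by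
  rw [Y_sub_Y hkn g₀]; rfl

/-- RUNS ARE SURVIVORS (converse).  Along ANY solution of (0.20) up to `K` that stays in `]0,γ]`, the clamped forward run started at its
own `g_0` reproduces it: `Y_k(g_0) = 1∕g_k²` and the clamped prefix IS the run's prefix, for every `k ≤ K` — the clamp is inactive along
genuine in-interval runs. [cite: Balaban1987RG1, (0.20) p.256] -/
theorem Y_eq_of_run {K : ℕ} {gs : ℕ → ℝ} (hrg : RGEqH K β gs) (hI : Step.InInterval γ K gs) :
    ∀ k, k ≤ K → Y β γ k (gs 0) = 1 / (gs k) ^ 2 ∧ clampPrefix β γ k (gs 0) = prefixOf gs k := by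
  -- first the values, by strong induction packaged as `∀ i ≤ k`
  have hval : ∀ k, k ≤ K → ∀ i, i ≤ k → Y β γ i (gs 0) = 1 / (gs i) ^ 2 := by
    intro k
    induction k with
    | zero => intro _ i hi; obtain rfl := Nat.le_zero.mp hi; exact Y_zero _
    | succ k ih =>
      intro hk i hi
      rcases Nat.lt_or_eq_of_le hi with hlt | rfl
      · exact ih (Nat.le_of_succ_le hk) i (Nat.lt_succ_iff.mp hlt)
      · have hprev := ih (Nat.le_of_succ_le hk)
        have hpre : clampPrefix β γ k (gs 0) = prefixOf gs k := by
          funext j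
          have hj : (j : ℕ) ≤ k := Nat.lt_succ_iff.mp j.isLt
          show gClamp γ (Y β γ j (gs 0)) = gs j
          rw [hprev j hj, gClamp_inv_sq (hI j (hj.trans (Nat.le_of_succ_le hk))).1
            (hI j (hj.trans (Nat.le_of_succ_le hk))).2]
        rw [Y_succ' k (gs 0), hprev k le_rfl, hpre, hrg k (Nat.lt_of_succ_le hk)]
        ring
  intro k hk
  refine ⟨hval k hk k le_rfl, ?_⟩
  funext j
  have hj : (j : ℕ) ≤ k := Nat.lt_succ_iff.mp j.isLt
  show gClamp γ (Y β γ j (gs 0)) = gs j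
  rw [hval k hk j hj, gClamp_inv_sq (hI j (hj.trans hk)).1 (hI j (hj.trans hk)).2]

/-- Hence an in-interval run of (0.20) is a SURVIVOR of the shooting from its own `g_0`: the clamp never acts along it. [folklore] -/
theorem survives_of_run {K : ℕ} {gs : ℕ → ℝ} (hrg : RGEqH K β gs) (hI : Step.InInterval γ K gs) :
    ∀ k, k ≤ K → 1 / γ ^ 2 ≤ Y β γ k (gs 0) := by
  intro k hk
  rw [(Y_eq_of_run hrg hI k hk).1]
  exact one_div_le_one_div_of_le (pow_pos (hI k hk).1 2) (pow_le_pow_left₀ (hI k hk).1.le (hI k hk).2 2)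

/-! ## §2 The shooting dichotomy (a supremum over unclamped survivors; continuity only) -/

/-- THE SEED FROM THE PRINTED UPPER BOUND.  With `β ≤ β′` on the boxes (`β′ ≥ 0`), the trial coupling `x_s = (1∕g² + β′K)^{−1∕2}` survives
to `K` and ends at or below `g`: `Y_k(x_s) ≥ 1∕g² + β′(K − k) ≥ 1∕g² ≥ 1∕γ²` (the tree's lower IVT endpoint, :541–:563 of `FlowStepRuns`).
[cite: Balaban1987RG1, §1 p.264] -/
theorem seed_of_upper (hγ : 0 < γ) {β' : ℝ} (hβ' : 0 ≤ β') (hhi : BetaUpperH β' γ β) {K : ℕ} {g : ℝ} (hg : 0 < g)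
    (hgγ : g ≤ γ) :
    ∃ xs : ℝ, 0 < xs ∧ xs ≤ g ∧ (∀ k, k ≤ K → 1 / γ ^ 2 ≤ Y β γ k xs) ∧ 1 / g ^ 2 ≤ Y β γ K xs := by
  have hγg : 1 / γ ^ 2 ≤ 1 / g ^ 2 := one_div_le_one_div_of_le (by positivity) (pow_le_pow_left₀ hg.le hgγ 2)
  set A : ℝ := 1 / g ^ 2 + β' * K with hA
  have hApos : 0 < A := by positivity
  set xs : ℝ := 1 / Real.sqrt A with hxs
  have hxs_pos : 0 < xs := by positivity
  have hxs_sq : 1 / xs ^ 2 = A := by rw [hxs, div_pow, one_pow, Real.sq_sqrt hApos.le, one_div_one_div]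
  have hxs_le_g : xs ≤ g := by
    have h1 : 1 / g ^ 2 ≤ 1 / xs ^ 2 := by rw [hxs_sq, hA]; linarith [mul_nonneg hβ' (Nat.cast_nonneg K)]
    have h2 : xs ^ 2 ≤ g ^ 2 := by rwa [one_div_le_one_div (by positivity) (by positivity)] at h1
    nlinarith [hxs_pos, hg]
  -- upper control of the clamped run from `xs`: `Y_0 − Y_k ≤ β′ k`
  have hup : ∀ k, Y β γ 0 xs - Y β γ k xs ≤ β' * k := by
    intro k
    rw [Y_sub_Y (Nat.zero_le k)]
    have hcard : ((Finset.Ico 0 k).card : ℝ) = k := by simp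
    have := Finset.sum_le_card_nsmul (Finset.Ico 0 k) (fun j => β j (clampPrefix β γ j xs)) β'
      (fun j _ => hhi j _ (clampPrefix_mem_box (β := β) hγ j xs))
    rw [nsmul_eq_mul, hcard] at this
    linarith
  have hYk : ∀ k, k ≤ K → 1 / g ^ 2 ≤ Y β γ k xs := by
    intro k hk
    have h := hup k
    rw [Y_zero, hxs_sq, hA] at h
    have hkK : (k : ℝ) ≤ K := by exact_mod_cast hk
    nlinarith [mul_le_mul_of_nonneg_left hkK hβ']
  exact ⟨xs, hxs_pos, hxs_le_g, fun k hk => hγg.trans (hYk k hk), hYk K le_rfl⟩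

/-- **THE SHOOTING DICHOTOMY.**  Let `β` be jointly continuous on the boxes `]0,γ]^{k+1}` (`γ > 0`), `0 < g`, and let `x_s ∈ ]0,γ]` be a
SEED: a trial coupling whose shooting trajectory survives to `K` (the clamp never acts) and ends at or below `g` (`1∕g² ≤ Y_K(x_s)`).  Then
EITHER some `x ∈ [x_s, γ]` survives to `K` and ends EXACTLY at `g` (`Y_K(x) = 1∕g²`) — an in-interval run of (0.20) from `x` to `g_K = g` —
OR some `x ∈ [x_s, γ]` survives to `K`, ends STRICTLY below `g` (`1∕g² < Y_K(x)`), and SITS AT `γ` at some step `k ≤ K` (`Y_k(x) = 1∕γ²`).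
Proof: `x = sup` of the closed, bounded, nonempty set of survivors in `[x_s, γ]` ending at or below `g`; if `Y_K(x) > 1∕g²` and no `Y_k(x)`
equals `1∕γ²`, continuity of the finitely many `Y_k` at `x` gives a larger member (or `x = γ`, where `Y_0(γ) = 1∕γ²`).  No sign, floor or
partial-sum hypothesis on β enters. [folklore] -/
theorem shooting_dichotomy (hγ : 0 < γ) (hcont : BetaContH γ β) {K : ℕ} {g xs : ℝ} (hxs : 0 < xs)
    (hxsγ : xs ≤ γ) (hseed : (∀ k, k ≤ K → 1 / γ ^ 2 ≤ Y β γ k xs) ∧ 1 / g ^ 2 ≤ Y β γ K xs) :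
    (∃ x, xs ≤ x ∧ x ≤ γ ∧ (∀ k, k ≤ K → 1 / γ ^ 2 ≤ Y β γ k x) ∧ Y β γ K x = 1 / g ^ 2) ∨
    (∃ x, xs ≤ x ∧ x ≤ γ ∧ (∀ k, k ≤ K → 1 / γ ^ 2 ≤ Y β γ k x) ∧ 1 / g ^ 2 < Y β γ K x ∧
        ∃ k, k ≤ K ∧ Y β γ k x = 1 / γ ^ 2) := by
  classical
  -- the closed pieces `S k c = {x ∈ [xs, γ] | c ≤ Y_k(x)}`
  have hYcont : ∀ k, ContinuousOn (Y β γ k) (Set.Icc xs γ) := fun k =>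
    (continuousOn_Y hγ hcont k).mono fun x hx => lt_of_lt_of_le hxs hx.1
  have hclosedS : ∀ (k : ℕ) (c : ℝ), IsClosed (Set.Icc xs γ ∩ Y β γ k ⁻¹' Set.Ici c) := fun k c =>
    (hYcont k).preimage_isClosed_of_isClosed isClosed_Icc isClosed_Ici
  set A : Set ℝ := (⋂ k : ℕ, ⋂ (_ : k ≤ K), (Set.Icc xs γ ∩ Y β γ k ⁻¹' Set.Ici (1 / γ ^ 2))) ∩
    (Set.Icc xs γ ∩ Y β γ K ⁻¹' Set.Ici (1 / g ^ 2)) with hAdef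
  have hmemA : ∀ x, x ∈ A ↔ (xs ≤ x ∧ x ≤ γ) ∧ (∀ k, k ≤ K → 1 / γ ^ 2 ≤ Y β γ k x) ∧ 1 / g ^ 2 ≤ Y β γ K x := by
    intro x
    simp only [hAdef, Set.mem_inter_iff, Set.mem_iInter, Set.mem_Icc, Set.mem_preimage, Set.mem_Ici]
    constructor
    · rintro ⟨h1, ⟨hx, h2⟩⟩; exact ⟨hx, fun k hk => (h1 k hk).2, h2⟩
    · rintro ⟨hx, h1, h2⟩; exact ⟨fun k hk => ⟨hx, h1 k hk⟩, hx, h2⟩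
  have hclosed : IsClosed A :=
    (isClosed_iInter fun k => isClosed_iInter fun _ => hclosedS k _).inter (hclosedS K _)
  have hxsA : xs ∈ A := (hmemA xs).2 ⟨⟨le_rfl, hxsγ⟩, hseed.1, hseed.2⟩
  have hne : A.Nonempty := ⟨xs, hxsA⟩
  have hbdd : BddAbove A := ⟨γ, fun x hx => ((hmemA x).1 hx).1.2⟩
  set x := sSup A with hxdef
  have hxA : x ∈ A := hclosed.csSup_mem hne hbdd
  obtain ⟨⟨hxsx, hxγ⟩, hsurv, hend⟩ := (hmemA x).1 hxA
  have hxpos : 0 < x := lt_of_lt_of_le hxs hxsx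
  by_cases heq : Y β γ K x = 1 / g ^ 2
  · exact Or.inl ⟨x, hxsx, hxγ, hsurv, heq⟩
  right
  have hlt : 1 / g ^ 2 < Y β γ K x := lt_of_le_of_ne hend (Ne.symm heq)
  refine ⟨x, hxsx, hxγ, hsurv, hlt, ?_⟩
  by_contra hno
  push Not at hno
  have hstrict : ∀ k, k ≤ K → 1 / γ ^ 2 < Y β γ k x := fun k hk => lt_of_le_of_ne (hsurv k hk) (Ne.symm (hno k hk))
  -- `x < γ`: at `x = γ` the step `k = 0` touches
  have hxltγ : x < γ := by
    rcases lt_or_eq_of_le hxγ with h | h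
    · exact h
    · exfalso
      have h0 := hstrict 0 (Nat.zero_le K)
      rw [Y_zero, h] at h0
      exact lt_irrefl _ h0
  -- continuity at `x > 0` of the finitely many `Y_k`, `k ≤ K`
  have hca : ∀ k, ContinuousAt (Y β γ k) x := fun k =>
    (continuousOn_Y hγ hcont k).continuousAt (Ioi_mem_nhds hxpos)
  have hev1 : ∀ᶠ y in 𝓝 x, ∀ k ∈ Finset.range (K + 1), 1 / γ ^ 2 < Y β γ k y := by
    rw [Filter.eventually_all_finset]
    intro k hk
    exact (hca k).eventually_const_lt (hstrict k (Nat.lt_succ_iff.mp (Finset.mem_range.mp hk)))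
  have hev2 : ∀ᶠ y in 𝓝 x, 1 / g ^ 2 < Y β γ K y := (hca K).eventually_const_lt hlt
  obtain ⟨ε, hε, hball⟩ := Metric.eventually_nhds_iff.mp (hev1.and hev2)
  -- a member of `A` above `x`
  set y : ℝ := min γ (x + ε / 2) with hydef
  have hxy : x < y := lt_min hxltγ (by linarith)
  have hyγ : y ≤ γ := min_le_left _ _
  have hdist : dist y x < ε := by
    rw [Real.dist_eq, abs_of_pos (sub_pos.mpr hxy)]
    have : y ≤ x + ε / 2 := min_le_right _ _
    linarith
  obtain ⟨h1, h2⟩ := hball hdist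
  have hyA : y ∈ A := (hmemA y).2 ⟨⟨hxsx.trans hxy.le, hyγ⟩,
    fun k hk => (h1 k (Finset.mem_range.mpr (Nat.lt_succ_of_le hk))).le, h2.le⟩
  exact absurd (le_csSup hbdd hyA) (not_le.mpr hxy)

/-- The dichotomy IN RUN LANGUAGE.  `β` continuous and `≤ β′` on the boxes `]0,γ]^{k+1}`, `0 < g ≤ γ`, any `K`: EITHER an in-interval solution
of (0.20) of length `K` ends exactly at `g`, OR an in-interval solution of length `K` sits at `γ` at some step `k ≤ K` and ends strictly
below `g` — in which case its window sum `Σ_{j∈[k,K)} β_j(g_0,…,g_j) = 1∕γ² − 1∕g_K²` is `< 1∕γ² − 1∕g²`. [folklore] -/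
theorem run_dichotomy (hγ : 0 < γ) {β' : ℝ} (hβ' : 0 ≤ β') (hcont : BetaContH γ β) (hhi : BetaUpperH β' γ β) (K : ℕ)
    {g : ℝ} (hg : 0 < g) (hgγ : g ≤ γ) :
    (∃ gs : ℕ → ℝ, gs K = g ∧ RGEqH K β gs ∧ Step.InInterval γ K gs) ∨
    (∃ gs : ℕ → ℝ, RGEqH K β gs ∧ Step.InInterval γ K gs ∧ gs K < g ∧ ∃ k, k ≤ K ∧ gs k = γ ∧
        ∑ j ∈ Finset.Ico k K, β j (prefixOf gs j) < 1 / γ ^ 2 - 1 / g ^ 2) := by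
  obtain ⟨xs, hxs, hxsg, hsv, hendK⟩ := seed_of_upper hγ hβ' hhi (K := K) hg hgγ
  rcases shooting_dichotomy hγ hcont hxs (hxsg.trans hgγ) ⟨hsv, hendK⟩ with
    ⟨x, -, -, hsurv, hY⟩ | ⟨x, -, -, hsurv, hlt, k, hk, hYk⟩
  · exact Or.inl ⟨fun k => gClamp γ (Y β γ k x), shoot_eq_of_Y_eq hg hY (hsurv K le_rfl),
      rgEqH_shoot_of_survives hγ hsurv, inInterval_shoot hγ K x⟩
  · right
    refine ⟨fun k => gClamp γ (Y β γ k x), rgEqH_shoot_of_survives hγ hsurv, inInterval_shoot hγ K x, ?_, k, hk,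
      shoot_eq_top_of_Y_eq hγ hYk, ?_⟩
    · -- `g_K < g` from `1∕g² < Y_K = 1∕g_K²`
      have hYK : 1 / (gClamp γ (Y β γ K x)) ^ 2 = Y β γ K x := inv_sq_gClamp hγ (hsurv K le_rfl)
      have hpos : 0 < gClamp γ (Y β γ K x) := gClamp_pos hγ _
      by_contra hge
      push Not at hge
      have : 1 / (gClamp γ (Y β γ K x)) ^ 2 ≤ 1 / g ^ 2 :=
        one_div_le_one_div_of_le (by positivity) (pow_le_pow_left₀ hg.le hge 2)
      linarith
    · rw [windowSum_shoot k K hk x, hYk]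
      linarith

/-! ## §3 Run-wise sufficiency: the END binder from partial sums bounded below ALONG IN-INTERVAL RUNS only -/

/-- **RUN-WISE SUFFICIENCY, TOP FORM (the weakest hypothesis the sup argument consumes).**  `β` jointly continuous and `≤ β′` on the boxes
`]0,γ]^{k+1}`, and: along every solution of (0.20) that stays in `]0,γ]` up to `n` and SITS AT `γ` at step `k ≤ n`, the window sum
`Σ_{j∈[k,n)} β_j(g_0,…,g_j)` is `≥ −M` (`M ≥ 0`) — i.e. no in-interval run falls, after visiting the top of the interval, by more than `M` in
`1∕g²`.  Then for every `K` and every target `g` with `1∕g² ≥ 1∕γ² + M` some bare coupling gives an in-interval run of (0.20) ending EXACTLY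
at `g_K = g`.  (The touching alternative of `run_dichotomy` would be such a run with window sum `< 1∕γ² − 1∕g² ≤ −M`.)  A REDUCTION of the
first sentence of [I] Thm 2 to a run-wise β-hypothesis; nothing printed is used except the upper bound. [cite: Balaban1987RG1, Thm 2 p.259] -/
theorem couplingTrajectory_exists_of_topRuns (β : HBeta) {γ M β' : ℝ} (hγ : 0 < γ) (hM : 0 ≤ M) (hβ' : 0 ≤ β')
    (hcont : BetaContH γ β) (hhi : BetaUpperH β' γ β)
    (htop : ∀ (n : ℕ) (gs : ℕ → ℝ), RGEqH n β gs → Step.InInterval γ n gs →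
      ∀ k, k ≤ n → gs k = γ → -M ≤ ∑ j ∈ Finset.Ico k n, β j (prefixOf gs j)) :
    ∀ (K : ℕ) (g : ℝ), 0 < g → 1 / γ ^ 2 + M ≤ 1 / g ^ 2 →
      ∃ gs : ℕ → ℝ, gs K = g ∧ RGEqH K β gs ∧ Step.InInterval γ K gs := by
  intro K g hg hgM
  have hγg : 1 / γ ^ 2 ≤ 1 / g ^ 2 := by linarith
  have hgγ : g ≤ γ := by
    have h2 : g ^ 2 ≤ γ ^ 2 := by rwa [one_div_le_one_div (by positivity) (by positivity)] at hγg
    nlinarith [hg, hγ]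
  rcases run_dichotomy hγ hβ' hcont hhi K hg hgγ with h | ⟨gs, hrg, hI, -, k, hk, hgsk, hsum⟩
  · exact h
  · exfalso
    have := htop K gs hrg hI k hk hgsk
    linarith

/-- **RUN-WISE SUFFICIENCY, WINDOW FORM** — the tree's `FlowStepRuns.couplingTrajectory_exists_partialSums` (:515) with (PS) asked ONLY
ALONG IN-INTERVAL SOLUTIONS of (0.20) (the class on which :497 proves it necessary), not along all box histories: continuity + `β ≤ β′` on the
boxes + `−M ≤ Σ_{j∈[k,n)} β_j(g_0,…,g_j)` for every in-interval run and `k ≤ n` ⟹ for every `K` and every `g` with `1∕g² ≥ 1∕γ² + M`, a run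
ending at `g_K = g` with the two-sided control `1∕g² − M ≤ 1∕g_k² ≤ 1∕g² + β′(K − k)`. [cite: Balaban1987RG1, Thm 2 p.259 and (0.20) p.256] -/
theorem couplingTrajectory_exists_of_runwisePS (β : HBeta) {γ M β' : ℝ} (hγ : 0 < γ) (hM : 0 ≤ M) (hβ' : 0 ≤ β')
    (hcont : BetaContH γ β) (hhi : BetaUpperH β' γ β)
    (hrun : ∀ (n : ℕ) (gs : ℕ → ℝ), RGEqH n β gs → Step.InInterval γ n gs →
      ∀ k, k ≤ n → -M ≤ ∑ j ∈ Finset.Ico k n, β j (prefixOf gs j)) :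
    ∀ (K : ℕ) (g : ℝ), 0 < g → 1 / γ ^ 2 + M ≤ 1 / g ^ 2 →
      ∃ gs : ℕ → ℝ, gs K = g ∧ RGEqH K β gs ∧ Step.InInterval γ K gs ∧
        ∀ k, k ≤ K → 1 / g ^ 2 - M ≤ 1 / (gs k) ^ 2 ∧ 1 / (gs k) ^ 2 ≤ 1 / g ^ 2 + β' * ((K : ℝ) - k) := by
  intro K g hg hgM
  obtain ⟨gs, hK, hrg, hI⟩ := couplingTrajectory_exists_of_topRuns β hγ hM hβ' hcont hhi
    (fun n gs hrg hI k hk _ => hrun n gs hrg hI k hk) K g hg hgM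
  refine ⟨gs, hK, hrg, hI, fun k hk => ?_⟩
  have ht := inv_sq_telescopeH hrg hk le_rfl
  rw [hK] at ht
  have hlo := hrun K gs hrg hI k hk
  have hcard : ((Finset.Ico k K).card : ℝ) = (K : ℝ) - k := by rw [Nat.card_Ico, Nat.cast_sub hk]
  have hup : ∑ j ∈ Finset.Ico k K, β j (prefixOf gs j) ≤ β' * ((K : ℝ) - k) := by
    rw [← hcard]
    have := Finset.sum_le_card_nsmul (Finset.Ico k K) (fun j => β j (prefixOf gs j)) β'
      (fun j hj => hhi j _ (mem_box.mpr fun i =>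
        hI i ((Nat.lt_succ_iff.mp i.isLt).trans (Finset.mem_Ico.mp hj).2.le)))
    rw [nsmul_eq_mul] at this
    linarith
  constructor <;> linarith

/-- **`DagBinding.EndpointExistence` FROM TOP RUNS, PER LEVEL (the weakest form the sup argument consumes at construction level;
g1-plan-2 X-90 P-2).**  `β` jointly continuous and `≤ β′` on the boxes `]0,γ₀]^{k+1}`, and for EACH level `γ ∈ ]0,γ₀]` SOME constant `M_γ ≥ 0`
such that no solution of (0.20) staying in `]0,γ]` that SITS AT `γ` at step `k` has a later window sum `Σ_{j∈[k,n)} β_j < −M_γ`.  Then for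
every `m`, every `γ ≤ γ₀`, with `g⋆ = (1∕γ² + M_γ)^{−1∕2}`, every `g ∈ ]0,g⋆]` and every `K`, some bare coupling gives a run of `C` in `]0,γ]`
with `g_K = g` (`ForwardGenerated` only, as :593). [cite: Balaban1987RG1, Thm 2 p.259] -/
theorem endpointExistence_of_topRunsPerLevel {C : B12.Construction} {β : HBeta} (hgen : ForwardGenerated C β)
    {γ₀ β' : ℝ} (hγ₀ : 0 < γ₀) (hβ' : 0 ≤ β') (hcont : BetaContH γ₀ β) (hhi : BetaUpperH β' γ₀ β)
    (htop : ∀ γ : ℝ, 0 < γ → γ ≤ γ₀ → ∃ M : ℝ, 0 ≤ M ∧ ∀ (n : ℕ) (gs : ℕ → ℝ), RGEqH n β gs → Step.InInterval γ n gs →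
      ∀ k, k ≤ n → gs k = γ → -M ≤ ∑ j ∈ Finset.Ico k n, β j (prefixOf gs j)) :
    EndpointExistence C := by
  intro m
  refine ⟨γ₀, hγ₀, fun γ hγ hγle => ?_⟩
  obtain ⟨M, hM, htopγ⟩ := htop γ hγ hγle
  set gstar : ℝ := 1 / Real.sqrt (1 / γ ^ 2 + M) with hgstar
  have hgstar_pos : 0 < gstar := by positivity
  refine ⟨gstar, hgstar_pos, fun g hg hgle K => ?_⟩
  have hgs : 1 / gstar ^ 2 = 1 / γ ^ 2 + M := by
    rw [hgstar, div_pow, one_pow, Real.sq_sqrt (by positivity), one_div_one_div]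
  have hgM : 1 / γ ^ 2 + M ≤ 1 / g ^ 2 := by
    rw [← hgs]
    exact one_div_le_one_div_of_le (by positivity) (pow_le_pow_left₀ hg.le hgle 2)
  have hcont' : BetaContH γ β := fun k => (hcont k).mono (box_mono hγle k)
  have hhi' : BetaUpperH β' γ β := fun k v hv => hhi k v (box_mono hγle k hv)
  obtain ⟨gs, hgsK, hrg, hI⟩ := couplingTrajectory_exists_of_topRuns β hγ hM hβ' hcont' hhi' htopγ K g hg hgM
  have heq : ∀ k, k ≤ K → (C ⟨K, m, gs 0⟩).flow.g k = gs k :=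
    flow_eq_of_rgEqH (C ⟨K, m, gs 0⟩).flow β K (fun k hk => hgen.2 ⟨K, m, gs 0⟩ k hk)
      (hgen.1 ⟨K, m, gs 0⟩) hrg (fun k hk => (hI k hk).1)
  refine ⟨gs 0, fun k hk => ?_, ?_⟩
  · rw [heq k hk]; exact hI k hk
  · rw [heq K le_rfl]; exact hgsK

/-- **`DagBinding.EndpointExistence` FROM THE RECORD FORM** (construction level; `ForwardGenerated` only, as :593).  `β` jointly continuous and
`≤ β′` on the boxes `]0,γ₀]^{k+1}`, and: along every in-interval (`]0,γ₀]`) solution of (0.20) up to `n`, every window `[k,n)` that STARTS AT A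
MAXIMUM OF THE RUN (`g_j ≤ g_k` for all `j ≤ n`) has `Σ β ≥ −M` — i.e. no in-interval run ends more than `M` (in `1∕g²`) below its own maximum.
Then for every `m`, every `γ ≤ γ₀`, `g⋆ = (1∕γ² + M)^{−1∕2}`, every `g ∈ ]0,g⋆]` and every `K`, some bare coupling gives a run of `C` in `]0,γ]`
with `g_K = g`.  (At level `γ` a run sitting at `γ` sits at its maximum.)
[cite: Balaban1987RG1, Thm 2 p.259] -/
theorem endpointExistence_of_recordRuns {C : B12.Construction} {β : HBeta} (hgen : ForwardGenerated C β)
    {γ₀ M β' : ℝ} (hγ₀ : 0 < γ₀) (hM : 0 ≤ M) (hβ' : 0 ≤ β') (hcont : BetaContH γ₀ β) (hhi : BetaUpperH β' γ₀ β)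
    (hrec : ∀ (n : ℕ) (gs : ℕ → ℝ), RGEqH n β gs → Step.InInterval γ₀ n gs →
      ∀ k, k ≤ n → (∀ j, j ≤ n → gs j ≤ gs k) → -M ≤ ∑ j ∈ Finset.Ico k n, β j (prefixOf gs j)) :
    EndpointExistence C :=
  endpointExistence_of_topRunsPerLevel hgen hγ₀ hβ' hcont hhi fun _ _ hγle =>
    ⟨M, hM, fun n gs hrg hI k hk hgk => hrec n gs hrg (fun i hi => ⟨(hI i hi).1, (hI i hi).2.trans hγle⟩) k hk
      (fun j hj => hgk ▸ (hI j hj).2)⟩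

/-- **`DagBinding.EndpointExistence` FROM RUN-WISE (PS)** — the END binder of the T⁴ headline from partial sums bounded below ALONG IN-INTERVAL
RUNS of (0.20) only (+ continuity + the printed upper bound), for any construction generated forward by (0.20) with `β`.  Supersedes in
scope `FlowStepRuns.endpointExistence_of_partialSums` (:593), whose (PS) quantifies over all box histories. [cite: Balaban1987RG1, Thm 2 p.259] -/
theorem endpointExistence_of_runwisePS {C : B12.Construction} {β : HBeta} (hgen : ForwardGenerated C β)
    {γ₀ M β' : ℝ} (hγ₀ : 0 < γ₀) (hM : 0 ≤ M) (hβ' : 0 ≤ β') (hcont : BetaContH γ₀ β) (hhi : BetaUpperH β' γ₀ β)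
    (hrun : ∀ (n : ℕ) (gs : ℕ → ℝ), RGEqH n β gs → Step.InInterval γ₀ n gs →
      ∀ k, k ≤ n → -M ≤ ∑ j ∈ Finset.Ico k n, β j (prefixOf gs j)) :
    EndpointExistence C :=
  endpointExistence_of_recordRuns hgen hγ₀ hM hβ' hcont hhi fun n gs hrg hI k hk _ => hrun n gs hrg hI k hk

end

end Summit.QuantumFields.BalabanUV.Gaps.EndRunwiseShooting
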